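import Literature.IUT.HodgeArakelov.ThetaEnvDataRecordAutSaturatedOfGalois
import Literature.IUT.HodgeArakelov.EtaleThetaDataOfSettingRootHypTransport

/-!
# [IUTchII] Prop 3.4 (i) at the GENUINE data with binder (P4) `hroot` REPLACED by the [EtTh] §1 transport statement
# `hE` (GAP row G-w5d169-2 reduced): residual = {F-0620, `hq`, `hE`, `hgal`}

S. Mochizuki, *Inter-universal Teichmüller theory II*, kurims manuscript (Dec. 2020): Prop 3.4 (i) pp. 91–92
[cite: Mochizuki2012, Prop 3.4 (i) p.91]; Prop 1.4 p. 27.  Claim key DISPUTED (D-0012).  [EtTh] (refereed): Thm. 1.6 (iii)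
p. 24, Prop. 2.4 p. 38, Cor. 2.19 (iii) p. 65 [cite: MochizukiEtTh2009, Thm 1.6 (iii) p.24].

abc-iut cell, WAVE-4 seat abc-iut-w4-d041 (gen 7), GAP row G-w5d169-2 (node IUTchII:Prop3.4(i), binder (P4)).  PROOF-ONLY
one-theorem corollary (no definition, no `Prop`-valued fact) of abc-iut-w5-d169's statement of record
`EtaleLevels.prop34i_multiradiallyDefined_saturated_ofGalois` (`ThetaEnvDataRecordAutSaturatedOfGalois.lean`) and this
seat's reduction `EtaleThetaDataOfSetting.rootHyp_of_forall_extends_transport` (`EtaleThetaDataOfSettingRootHypTransport.lean`,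
p436936): the root hypothesis `hroot` (∀ α, ∃ τ ε, l•ε = 0 ∧ ρ^⊤_α η̲̈ = conj_τ η̲̈ + ε) is SUPPLIED by
`hE` : every `α ∈ Aut_top(Π^tp_X̲̲)` extends to some `γ ∈ Aut_top(Π^tp_X)` with `γ(Π^tp_Ÿ) = Π^tp_Ÿ` ([EtTh] Prop 2.4 / Thm 1.6 (i)),
a theta companion ([EtTh] Thm 1.6 (ii)) and `transport (η̈^Θ) = conj_τ (η̈^Θ)` pulled back to `Π^tp_Ÿ̲̲` for some `τ ∈ Π^tp_X̲̲`
([EtTh] Thm 1.6 (iii) + Thm 1.10 (i), zero label and sign fixed).  So the node's residual reads {F-0620, `hq`, `hE`, `hgal`}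
(+ the record/tower inputs), every member an [EtTh] §1–§2 / [AbsTopIII]-shaped statement.
Nothing here asserts anything of [IUTchII]; no side taken on [IUTchIII] Cor. 3.12; typed ≠ proved.
-/

noncomputable section

open Topology

namespace Literature.IUT.HodgeArakelov

open Literature.AnabelianGeometry.EtaleTheta Literature.AnabelianGeometry.SemiGraphs
open CohomologySystemOfContH1 EtaleThetaDataOfSetting TemperedThetaMonoids
open scoped Literature.AnabelianGeometry.EtaleTheta

namespace EtaleLevels

variable {p : ℕ} [Fact p.Prime] {D : Literature.AnabelianGeometry.EtaleTheta.ThetaSetting p}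
  {E : D.EtaleThetaData} {l : ℕ} (C : E.DoubleUnderline l) (hC : D.Compat) (hS : D.Sec2Hyps)
  (hl : l.Prime) (hp2 : p ≠ 2) (hpl : p ≠ l) (hζ : ∃ ζ : D.K, IsPrimitiveRoot ζ (4 * l))
  (mods : ∀ M : ℕ+, D.CyclotomeMod l M)
  (f : contCocycles D.toTheta D.DeltaTheta C.GtpYdduu) (hf : f ∈ C.rootCocycles hC)
  (hmods : ∀ (M M' : ℕ+) (h : (M : ℕ) ∣ (M' : ℕ)) (x : D.lDeltaTheta l),
    MuN.red p M M' h ((mods M').red x) = (mods M).red x)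
  (h15 : Literature.AnabelianGeometry.EtaleTheta.ThetaSetting.Prop15iii E hC) (L : C.CuspLabels)
  (hZ : ∀ M : ℕ+, Nonempty (ModelCyclotomes.lDeltaQuot (C.rigidData (mods M) hC hS h15 L) ≃*
    Literature.IUT.HodgeTheaters.ZHat))
  (hcharY : EtaleThetaDataOfSetting.PiYddCharacteristic C)
  (hlim : Function.Bijective (rigidLimHom C hC hS hl hp2 hpl hζ mods f hf hmods h15 L hZ))
  [(EtaleThetaDataOfSetting.PiYdd C).Normal] [D.GtpYdd.Normal]
  (hq : IsQuotientMap D.toTheta) {N : ℕ+} (μ : D.CyclotomeMod l N)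
  (R : RigidData.{0} N l) (hR : R = C.rigidData μ hC hS h15 L) (h218i : R.Cor218_i)
  (hE : ∀ α : (Pi C) ≃ₜ* (Pi C), ∃ (γ : D.PiTemp ≃ₜ* D.PiTemp)
    (_ : ∀ x : Pi C, ((α x : Pi C) : D.PiTemp) = γ (x : D.PiTemp)) (h : ThetaSetting.Thm16i γ)
    (c : ThetaSetting.ThetaCompanion γ) (τ : Pi C),
    ContH1.comap D.toTheta D.DeltaTheta C.Huu.subtype continuous_subtype_val
        (map_subtype_piYdd_inf_le_GtpYdd C ⊤) (ThetaSetting.transport c h E.etaDd) =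
      ContH1.comap D.toTheta D.DeltaTheta C.Huu.subtype continuous_subtype_val
        (map_subtype_piYdd_inf_le_GtpYdd C ⊤) (ContH1.conj D.toTheta D.DeltaTheta (τ : D.PiTemp) E.etaDd))
  (ι₀ : (Pi C) ≃ₜ* (Pi C))
  {Es : Set ℕ+} (τw : D.CyclotomeTower l Es)
  (O : Submonoid (PadicAlgCl p)ˣ)
  (hO : ∀ (σ : GQp p) (u : (PadicAlgCl p)ˣ), u ∈ O → Units.map (σ : PadicAlgCl p →* PadicAlgCl p) u ∈ O)
  (hO' : D.IsEtThOrigin)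
  (hgal : ∀ α : (Pi C) ≃ₜ* (Pi C), ∃ τ : GQp p,
    (∀ x : Pi C, aug C (α x) = τ * aug C x * τ⁻¹) ∧
    (∀ (M : ℕ+) (z w : D.lDeltaTheta l),
      ((rangeAutOfCor218i C μ hq hC hS h15 L R hR h218i α
          ⟨(z : D.GtpTheta), lDeltaTheta_le_phiRange C z.2⟩ : phiRange C) : D.GtpTheta) = (w : D.GtpTheta) →
        (τw.modAll M).red w = galMuN p M τ ((τw.modAll M).red z)))

/-- **[IUTchII] Prop 3.4 (i) at the genuine functor, (P4) in [EtTh] §1 shape**: abc-iut-w5-d169's statement of record with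
`hroot` supplied by `hE` (extension of `α` to `Π^tp_X` + theta companion + «transport (η̈^Θ) = conj_τ (η̈^Θ)», `τ ∈ Π^tp_X̲̲`)
through this seat's `rootHyp_of_forall_extends_transport` — residual {F-0620, `hq`, `hE`, `hgal`}.
[cite: Mochizuki2012, Prop 3.4 (i) p.92] -/
theorem prop34i_multiradiallyDefined_saturated_ofExtendsTransport
    (c : CyclotomeCoefficients (phi C) (D.lDeltaTheta l) (PadicAlgCl p)ˣ)
    (hlev : ∀ (ζ : cyclotome (PadicAlgCl p)ˣ) (M : ℕ+),
      (((τw.modAll M).red (c.hom ζ) : MuN p M) : (PadicAlgCl p)ˣ) = (ζ : ℕ+ → (PadicAlgCl p)ˣ) M)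
    {η : (C.thetaEnvData μ hC hS).PiYdd → MuN p N} (hη : η ∈ (C.thetaEnvData μ hC hS).thetaCocycles)
    (Γ : Type) [Group Γ] :
    ((ex18iii (ThetaSetting.ofDoubleUnderline C μ hC hS hl hp2 hpl hζ hη) Γ).toDagger
      (TemperedThetaMonoids.prop34iRadialFunctor
        (thetaEnvTransportS C hC hS hl hp2 hpl hζ mods f hf hmods h15 L hZ hcharY hlim hq μ R hR h218i
          (h1LimKummerOn (phi C) (D.lDeltaTheta l) (PiYdd C) c (isOpen_stabilizer_units C)
            (finiteIndex_stabilizer_units C) O) ι₀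
          (map_mrange_h1LimKummerOn_eq_of_galois C hq μ τw c hlev O hO hC hS h15 L R hR h218i hO' hgal)
          (image_toLim_theta_thetaEnvData_of_rootHyp C hC hS hl hp2 hpl hζ mods f hf hmods h15 L hZ hcharY hlim hq
            μ R hR h218i (rootHyp_of_forall_extends_transport C hq μ hC hS h15 L R hR h218i hE))
          (image_thetaInfty_thetaEnvData_of_rootHyp C hC hS hl hp2 hpl hζ mods f hf hmods h15 L hZ hcharY hlim hq μ
            R hR h218i (rootHyp_of_forall_extends_transport C hq μ hC hS h15 L R hR h218i hE)) hη)
        Γ)).IsMultiradiallyDefined :=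
  prop34i_multiradiallyDefined_saturated_ofGalois C hC hS hl hp2 hpl hζ mods f hf hmods h15 L hZ hcharY hlim hq μ R hR
    h218i (rootHyp_of_forall_extends_transport C hq μ hC hS h15 L R hR h218i hE) ι₀ τw O hO hO' hgal c hlev hη Γ

/-- **The same with the coefficient datum discharged** (abc-iut-w4-d007's `exists_cyclotomeCoefficients_of_cyclotomeTower`):
residual {F-0620, `hq`, `hE`, `hgal`, `hO'`, `hΔ`}. [cite: Mochizuki2012, Prop 3.4 (i) p.92] -/
theorem exists_coeff_prop34i_multiradiallyDefined_saturated_ofExtendsTransport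
    (hΔ : IsCompact (D.DeltaTheta : Set D.GtpTheta))
    {η : (C.thetaEnvData μ hC hS).PiYdd → MuN p N} (hη : η ∈ (C.thetaEnvData μ hC hS).thetaCocycles)
    (Γ : Type) [Group Γ] :
    ∃ (c : CyclotomeCoefficients (phi C) (D.lDeltaTheta l) (PadicAlgCl p)ˣ)
      (hlev : ∀ (ζ : cyclotome (PadicAlgCl p)ˣ) (M : ℕ+),
        (((τw.modAll M).red (c.hom ζ) : MuN p M) : (PadicAlgCl p)ˣ) = (ζ : ℕ+ → (PadicAlgCl p)ˣ) M),
      Function.Bijective c.hom ∧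
      ((ex18iii (ThetaSetting.ofDoubleUnderline C μ hC hS hl hp2 hpl hζ hη) Γ).toDagger
        (TemperedThetaMonoids.prop34iRadialFunctor
          (thetaEnvTransportS C hC hS hl hp2 hpl hζ mods f hf hmods h15 L hZ hcharY hlim hq μ R hR h218i
            (h1LimKummerOn (phi C) (D.lDeltaTheta l) (PiYdd C) c (isOpen_stabilizer_units C)
              (finiteIndex_stabilizer_units C) O) ι₀
            (map_mrange_h1LimKummerOn_eq_of_galois C hq μ τw c hlev O hO hC hS h15 L R hR h218i hO' hgal)
            (image_toLim_theta_thetaEnvData_of_rootHyp C hC hS hl hp2 hpl hζ mods f hf hmods h15 L hZ hcharY hlim hq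
              μ R hR h218i (rootHyp_of_forall_extends_transport C hq μ hC hS h15 L R hR h218i hE))
            (image_thetaInfty_thetaEnvData_of_rootHyp C hC hS hl hp2 hpl hζ mods f hf hmods h15 L hZ hcharY hlim hq
              μ R hR h218i (rootHyp_of_forall_extends_transport C hq μ hC hS h15 L R hR h218i hE)) hη)
          Γ)).IsMultiradiallyDefined :=
  exists_coeff_prop34i_multiradiallyDefined_saturated_ofGalois C hC hS hl hp2 hpl hζ mods f hf hmods h15 L hZ hcharY
    hlim hq μ R hR h218i (rootHyp_of_forall_extends_transport C hq μ hC hS h15 L R hR h218i hE) ι₀ τw O hO hO' hgal hΔ hη Γ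

end EtaleLevels

end Literature.IUT.HodgeArakelov

end
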